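import Mathlib
import Literature.Analysis.FluidPDE.VectorCalculus
import Literature.Analysis.FluidPDE.VectorCalculusProofs
import Literature.Analysis.FluidPDE.WholeSpaceIBP
import Literature.Analysis.FluidPDE.VorticityCalculus
import Literature.Analysis.FluidPDE.PoincareHomotopyOperator
import Summits.NavierStokesRegularity.NavierStokesRegularity.Theorems.LandauTailLandauTailBlowupScaledTest
import Summits.NavierStokesRegularity.NavierStokesRegularity.Theorems.LandauTailLandauTailBlowupFluxIdentity

set_option linter.dupNamespace false

/-!
# The solenoidal plateau test field (stub `landauTail_exists_plateau_test`, W1)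

Helper file for crux `LandauTailBlowup` (stmt-NavierStokesRegularity-1944), line `registered`,
registered stub `landauTail_exists_plateau_test`: for every `a ∈ ℝ³` there is a constant `K ≥ 0`
such that for every radius `ρ > 0` there are `C^∞` compactly supported fields `φ, Ψ : ℝ³ → ℝ³`
with `tsupport φ, tsupport Ψ ⊆ B(0, ρ)`, `div φ ≡ 0`, `φ = a` on the closed ball `B̄(0, ρ/2)`
(the *plateau*, where therefore `Dφ = 0` and `Δφ = 0`), `φ = curl Ψ`, and the scale-sharp bounds
`‖φ‖ ≤ K`, `‖Dφ‖ ≤ K/ρ`, `‖Δφ‖ ≤ K/ρ²`, `‖Ψ‖ ≤ Kρ`.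

Construction.  Unit scale: `Ψ₁(y) = ½ η(‖y‖²) (a × y)` with the plateau profile
`η(t) = smoothTransition (3 − 4t)` (`= 1` on `(−∞, 1/2]`, `= 0` on `[3/4, ∞)`), and
`φ₁ := curl Ψ₁`; on the open set `{‖y‖² < 1/2} ⊃ B̄(0, 1/2)` one has `Ψ₁(y) = ½ a × y`, whose curl
is `a`; `div curl = 0` (tree: `divergence_curl_eq_zero_holds`); supports sit in `B̄(0, 9/10)`.
Scale `ρ`: `φ(x) = φ₁(ρ⁻¹x)`, `Ψ(x) = ρ Ψ₁(ρ⁻¹x)` (so `DΨ(x) = DΨ₁(ρ⁻¹x)` and `curl Ψ = φ`);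
`K` is the maximum of the four suprema `sup ‖φ₁‖, sup ‖Dφ₁‖, sup ‖Δφ₁‖, sup ‖Ψ₁‖` (continuous,
compactly supported), and the bounds follow from `D(φ₁(ρ⁻¹·)) = ρ⁻¹ Dφ₁(ρ⁻¹·)`
(`fderiv_comp_smul`) and `Δ(φ₁(ρ⁻¹·)) = ρ⁻² (Δφ₁)(ρ⁻¹·)` (`landauTail_laplacian_comp_smul`).
[folklore]
-/

namespace Summit.NavierStokesRegularity.NavierStokesRegularity.Theorems

open Metric Set Filter Topology InnerProductSpace Literature.Analysis.FluidPDE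
open scoped RealInnerProductSpace Laplacian

/-- **A smooth plateau profile**: `η(t) = smoothTransition (3 − 4t)` is `C^∞`, equals `1` on
`(−∞, 1/2]` and `0` on `[3/4, ∞)`. [folklore] -/
theorem landauTail_exists_plateau_profile : ∃ η : ℝ → ℝ, ContDiff ℝ (⊤ : ℕ∞) η ∧
    (∀ t : ℝ, t ≤ 1 / 2 → η t = 1) ∧ (∀ t : ℝ, 3 / 4 ≤ t → η t = 0) :=
  ⟨fun t => Real.smoothTransition (3 - 4 * t),
    Real.smoothTransition.contDiff.comp (contDiff_const.sub (contDiff_const.mul contDiff_id)),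
    fun _ ht => Real.smoothTransition.one_of_one_le (by linarith),
    fun _ ht => Real.smoothTransition.zero_of_nonpos (by linarith)⟩

/-- **Smoothness of the vector potential** `Ψ₁(y) = ½ η(‖y‖²) (a × y)` for a smooth profile `η`
(products and compositions of smooth maps; `y ↦ a × y` is linear). [folklore] -/
theorem landauTail_plateauPotential_contDiff {η : ℝ → ℝ} (hη : ContDiff ℝ (⊤ : ℕ∞) η)
    (a : EuclideanSpace ℝ (Fin 3)) :
    ContDiff ℝ (⊤ : ℕ∞) fun y : EuclideanSpace ℝ (Fin 3) => (2⁻¹ * η (‖y‖ ^ 2)) • cross a y := by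
  have hc : ContDiff ℝ (⊤ : ℕ∞) fun y : EuclideanSpace ℝ (Fin 3) => cross a y :=
    (crossCLM a).contDiff
  exact (contDiff_const.mul (hη.comp (contDiff_norm_sq ℝ))).smul hc

/-- **Support of the vector potential**: if `η = 0` on `[3/4, ∞)` then `Ψ₁(y) = ½ η(‖y‖²) (a × y)`
vanishes for `‖y‖ > 9/10` (as `(9/10)² > 3/4`), so `support Ψ₁ ⊆ B̄(0, 9/10)`. [folklore] -/
theorem landauTail_plateauPotential_support {η : ℝ → ℝ} (h0 : ∀ t : ℝ, 3 / 4 ≤ t → η t = 0)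
    (a : EuclideanSpace ℝ (Fin 3)) :
    (Function.support fun y : EuclideanSpace ℝ (Fin 3) => (2⁻¹ * η (‖y‖ ^ 2)) • cross a y) ⊆
      closedBall (0 : EuclideanSpace ℝ (Fin 3)) (9 / 10) := by
  intro y hy
  rw [mem_closedBall, dist_zero_right]
  by_contra h
  have h' : 3 / 4 ≤ ‖y‖ ^ 2 := by nlinarith
  exact hy (by simp [h0 _ h'])

/-- **The plateau**: if `η = 1` on `(−∞, 1/2]` then on the open set `{‖x‖² < 1/2}` the potential
`Ψ₁(y) = ½ η(‖y‖²) (a × y)` agrees with the linear field `y ↦ ½ a × y`, whose curl is `a`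
(`curl (y ↦ a × y) = 2a`, tree `curlCLM_crossCLM`); hence `curl Ψ₁ x = a` there. [folklore] -/
theorem landauTail_curl_plateauPotential {η : ℝ → ℝ} (h1 : ∀ t : ℝ, t ≤ 1 / 2 → η t = 1)
    (a : EuclideanSpace ℝ (Fin 3)) {x : EuclideanSpace ℝ (Fin 3)} (hx : ‖x‖ ^ 2 < 1 / 2) :
    curl (fun y => (2⁻¹ * η (‖y‖ ^ 2)) • cross a y) x = a := by
  have hev : (fun y => (2⁻¹ * η (‖y‖ ^ 2)) • cross a y) =ᶠ[𝓝 x] ⇑((2⁻¹ : ℝ) • crossCLM a) := by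
    have hU : IsOpen {y : EuclideanSpace ℝ (Fin 3) | ‖y‖ ^ 2 < 1 / 2} :=
      isOpen_lt (by fun_prop) continuous_const
    filter_upwards [hU.mem_nhds (show x ∈ {y | ‖y‖ ^ 2 < 1 / 2} from hx)] with y hy
    have hy' : ‖y‖ ^ 2 < 1 / 2 := hy
    simp [h1 _ hy'.le]
  rw [curl_eq_curlCLM, hev.fderiv_eq, ContinuousLinearMap.fderiv, map_smul, curlCLM_crossCLM,
    smul_smul]
  norm_num

/-- **The unit-scale plateau test field**: for every `a ∈ ℝ³` there are `φ, Ψ ∈ C_c^∞(ℝ³; ℝ³)`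
supported in the unit ball with `φ = curl Ψ`, `div φ ≡ 0` and `φ = a` on `{‖x‖² < 1/2}`; witness
`Ψ(y) = ½ η(‖y‖²) (a × y)` with the plateau profile of `landauTail_exists_plateau_profile`.
[folklore] -/
theorem landauTail_exists_plateau_test_unit (a : EuclideanSpace ℝ (Fin 3)) :
    ∃ φ Ψ : EuclideanSpace ℝ (Fin 3) → EuclideanSpace ℝ (Fin 3), ContDiff ℝ (⊤ : ℕ∞) φ ∧
      HasCompactSupport φ ∧ tsupport φ ⊆ ball (0 : EuclideanSpace ℝ (Fin 3)) 1 ∧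
      (∀ x, VectorCalculus.divergence φ x = 0) ∧ (∀ x, ‖x‖ ^ 2 < 1 / 2 → φ x = a) ∧
      ContDiff ℝ (⊤ : ℕ∞) Ψ ∧ HasCompactSupport Ψ ∧
      tsupport Ψ ⊆ ball (0 : EuclideanSpace ℝ (Fin 3)) 1 ∧ φ = curl Ψ := by
  obtain ⟨η, hη, h1, h0⟩ := landauTail_exists_plateau_profile
  have hΨs := landauTail_plateauPotential_contDiff hη a
  have hsupp := landauTail_plateauPotential_support h0 a
  have hΨc : HasCompactSupport fun y => (2⁻¹ * η (‖y‖ ^ 2)) • cross a y :=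
    HasCompactSupport.of_support_subset_isCompact (isCompact_closedBall _ _) hsupp
  have hΨt : (tsupport fun y => (2⁻¹ * η (‖y‖ ^ 2)) • cross a y) ⊆
      ball (0 : EuclideanSpace ℝ (Fin 3)) 1 :=
    (closure_minimal hsupp isClosed_closedBall).trans (closedBall_subset_ball (by norm_num))
  refine ⟨curl fun y => (2⁻¹ * η (‖y‖ ^ 2)) • cross a y, fun y => (2⁻¹ * η (‖y‖ ^ 2)) • cross a y,
    contDiff_curl (n := (⊤ : ℕ∞)) (by exact_mod_cast hΨs), hasCompactSupport_curl hΨc, ?_,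
    fun x => divergence_curl_eq_zero_holds _ (contDiff_infty.1 hΨs 2) x,
    fun x hx => landauTail_curl_plateauPotential h1 a hx, hΨs, hΨc, hΨt, rfl⟩
  -- `tsupport (curl Ψ) ⊆ tsupport Ψ ⊆ B(0, 1)`
  refine (closure_minimal (fun x hx => ?_) (isClosed_tsupport _)).trans hΨt
  by_contra h
  exact hx (curl_eq_zero_of_notMem_tsupport h)

/-- **The solenoidal plateau test field** (registered stub W1 of crux `LandauTailBlowup`,
stmt-NavierStokesRegularity-1944): for every `a ∈ ℝ³` there is `K ≥ 0` such that for every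
`ρ > 0` there are `φ, Ψ ∈ C_c^∞(ℝ³; ℝ³)` supported in `B(0, ρ)` with `div φ ≡ 0`, `φ = a`, `Dφ = 0`,
`Δφ = 0` on `B̄(0, ρ/2)`, `‖φ‖ ≤ K`, `‖Dφ‖ ≤ K/ρ`, `‖Δφ‖ ≤ K/ρ²`, `φ = curl Ψ`, `‖Ψ‖ ≤ Kρ`.
Witness: `φ = φ₁(ρ⁻¹·)`, `Ψ = ρ Ψ₁(ρ⁻¹·)` with `(φ₁, Ψ₁)` the unit-scale pair of
`landauTail_exists_plateau_test_unit`, `K = max (sup ‖φ₁‖) (sup ‖Dφ₁‖) (sup ‖Δφ₁‖) (sup ‖Ψ₁‖)`.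
[folklore] -/
theorem landauTail_exists_plateau_test : ∀ a : EuclideanSpace ℝ (Fin 3), ∃ K : ℝ, 0 ≤ K ∧ ∀ ρ : ℝ, 0 < ρ → ∃ (φ Ψ : EuclideanSpace ℝ (Fin 3) → EuclideanSpace ℝ (Fin 3)), ContDiff ℝ (⊤ : ℕ∞) φ ∧ HasCompactSupport φ ∧ tsupport φ ⊆ Metric.ball (0 : EuclideanSpace ℝ (Fin 3)) ρ ∧ (∀ x, Literature.Analysis.FluidPDE.VectorCalculus.divergence φ x = 0) ∧ (∀ x ∈ Metric.closedBall (0 : EuclideanSpace ℝ (Fin 3)) (ρ / 2), φ x = a) ∧ (∀ x ∈ Metric.closedBall (0 : EuclideanSpace ℝ (Fin 3)) (ρ / 2), fderiv ℝ φ x = 0) ∧ (∀ x ∈ Metric.closedBall (0 : EuclideanSpace ℝ (Fin 3)) (ρ / 2), Laplacian.laplacian φ x = 0) ∧ (∀ x, ‖φ x‖ ≤ K) ∧ (∀ x, ‖fderiv ℝ φ x‖ ≤ K / ρ) ∧ (∀ x, ‖Laplacian.laplacian φ x‖ ≤ K / ρ ^ 2) ∧ ContDiff ℝ (⊤ : ℕ∞)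 Ψ ∧ HasCompactSupport Ψ ∧ tsupport Ψ ⊆ Metric.ball (0 : EuclideanSpace ℝ (Fin 3)) ρ ∧ (∀ x, φ x = Literature.Analysis.FluidPDE.curl Ψ x) ∧ (∀ x, ‖Ψ x‖ ≤ K * ρ) := by
  intro a
  obtain ⟨φ₁, Ψ₁, hφs, hφc, hφt, hφd, hφa, hΨs, hΨc, hΨt, hφΨ⟩ :=
    landauTail_exists_plateau_test_unit a
  have hφ2 : ContDiff ℝ 2 φ₁ := contDiff_infty.1 hφs 2
  -- the plateau germ: `φ₁` is locally constant `= a` on the open set `{‖z‖² < 1/2}`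
  have hU : IsOpen {y : EuclideanSpace ℝ (Fin 3) | ‖y‖ ^ 2 < 1 / 2} :=
    isOpen_lt (by fun_prop) continuous_const
  have hgerm : ∀ z : EuclideanSpace ℝ (Fin 3), ‖z‖ ^ 2 < 1 / 2 → φ₁ =ᶠ[𝓝 z] fun _ => a :=
    fun z hz => eventuallyEq_of_mem (hU.mem_nhds (show z ∈ {y | ‖y‖ ^ 2 < 1 / 2} from hz))
      fun y hy => hφa y hy
  -- the four suprema
  obtain ⟨C₁, hC₁⟩ := hφs.continuous.bounded_above_of_compact_support hφc
  obtain ⟨C₂, hC₂⟩ :=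
    (hφs.continuous_fderiv (by simp)).bounded_above_of_compact_support (hφc.fderiv (𝕜 := ℝ))
  obtain ⟨C₃, hC₃⟩ := (continuous_laplacian hφ2).bounded_above_of_compact_support
    (hφc.mono' fun x hx => not_not.1 fun h => hx (laplacian_eq_zero_of_notMem_tsupport h))
  obtain ⟨C₄, hC₄⟩ := hΨs.continuous.bounded_above_of_compact_support hΨc
  have hK₁ : C₁ ≤ max (max C₁ C₂) (max C₃ C₄) := (le_max_left _ _).trans (le_max_left _ _)
  have hK₂ : C₂ ≤ max (max C₁ C₂) (max C₃ C₄) := (le_max_right _ _).trans (le_max_left _ _)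
  have hK₃ : C₃ ≤ max (max C₁ C₂) (max C₃ C₄) := (le_max_left _ _).trans (le_max_right _ _)
  have hK₄ : C₄ ≤ max (max C₁ C₂) (max C₃ C₄) := (le_max_right _ _).trans (le_max_right _ _)
  refine ⟨max (max C₁ C₂) (max C₃ C₄), ((norm_nonneg _).trans (hC₁ 0)).trans hK₁, fun ρ hρ => ?_⟩
  have hρ' : 0 < ρ⁻¹ := inv_pos.2 hρ
  -- supports after rescaling: `tsupport (f ∘ (ρ⁻¹ • ·)) ⊆ (ρ⁻¹ • ·)⁻¹' tsupport f ⊆ B(0, ρ)`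
  have hsub : ∀ f : EuclideanSpace ℝ (Fin 3) → EuclideanSpace ℝ (Fin 3),
      tsupport f ⊆ ball (0 : EuclideanSpace ℝ (Fin 3)) 1 →
      tsupport (fun x => f (ρ⁻¹ • x)) ⊆ ball (0 : EuclideanSpace ℝ (Fin 3)) ρ := fun f hf x hx => by
    have h1 := hf (tsupport_comp_subset_preimage f
      (f := fun x : EuclideanSpace ℝ (Fin 3) => ρ⁻¹ • x) (continuous_const_smul ρ⁻¹) hx)
    rw [mem_ball, dist_zero_right] at h1 ⊢
    rw [norm_smul, Real.norm_eq_abs, abs_of_pos hρ'] at h1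
    calc ‖x‖ = ρ * (ρ⁻¹ * ‖x‖) := by field_simp
      _ < ρ * 1 := mul_lt_mul_of_pos_left h1 hρ
      _ = ρ := mul_one ρ
  -- the closed ball `B̄(0, ρ/2)` is mapped into the plateau `{‖z‖² < 1/2}`
  have hin : ∀ x ∈ closedBall (0 : EuclideanSpace ℝ (Fin 3)) (ρ / 2), ‖ρ⁻¹ • x‖ ^ 2 < 1 / 2 := by
    intro x hx
    rw [mem_closedBall, dist_zero_right] at hx
    rw [norm_smul, Real.norm_eq_abs, abs_of_pos hρ']
    have h0 : 0 ≤ ρ⁻¹ * ‖x‖ := mul_nonneg hρ'.le (norm_nonneg x)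
    have h2 : ρ⁻¹ * ‖x‖ ≤ 1 / 2 := by
      rw [inv_mul_le_iff₀ hρ]
      linarith
    nlinarith
  refine ⟨fun x => φ₁ (ρ⁻¹ • x), fun x => ρ • Ψ₁ (ρ⁻¹ • x), hφs.comp (contDiff_const_smul _),
    hφc.comp_smul hρ'.ne', hsub φ₁ hφt, fun x => ?_, fun x hx => hφa _ (hin x hx),
    fun x hx => ?_, fun x hx => ?_, fun x => (hC₁ _).trans hK₁, fun x => ?_, fun x => ?_,
    (hΨs.comp (contDiff_const_smul _)).const_smul ρ,
    HasCompactSupport.smul_left (f := fun _ : EuclideanSpace ℝ (Fin 3) => ρ)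
      (hΨc.comp_smul hρ'.ne'),
    (tsupport_smul_subset_right (fun _ : EuclideanSpace ℝ (Fin 3) => ρ) fun x => Ψ₁ (ρ⁻¹ • x)).trans
      (hsub Ψ₁ hΨt),
    fun x => ?_, fun x => ?_⟩
  · -- solenoidality
    rw [landauTail_divergence_comp_smul, hφd, mul_zero]
  · -- `Dφ = 0` on the plateau
    rw [fderiv_comp_smul, (hgerm _ (hin x hx)).fderiv_eq]
    simp
  · -- `Δφ = 0` on the plateau
    rw [landauTail_laplacian_comp_smul hφ2, (laplacian_congr_nhds (hgerm _ (hin x hx))).eq_of_nhds,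
      congrFun (laplacian_eq_iteratedFDeriv_stdOrthonormalBasis _) (ρ⁻¹ • x)]
    simp [iteratedFDeriv_const_of_ne]
  · -- gradient bound
    rw [fderiv_comp_smul, norm_smul, Real.norm_eq_abs, abs_of_pos hρ', div_eq_inv_mul]
    exact mul_le_mul_of_nonneg_left ((hC₂ _).trans hK₂) hρ'.le
  · -- Laplacian bound
    rw [landauTail_laplacian_comp_smul hφ2, norm_smul, norm_pow, Real.norm_eq_abs,
      abs_of_pos hρ', inv_pow, div_eq_inv_mul]
    exact mul_le_mul_of_nonneg_left ((hC₃ _).trans hK₃) (by positivity)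
  · -- curl representation: `D(ρ Ψ₁(ρ⁻¹ ·))(x) = DΨ₁(ρ⁻¹ x)`
    have hd : DifferentiableAt ℝ (fun y : EuclideanSpace ℝ (Fin 3) => Ψ₁ (ρ⁻¹ • y)) x :=
      (hΨs.comp (contDiff_const_smul _)).differentiable (by simp) x
    rw [curl_const_smul hd, curl_eq_curlCLM, fderiv_comp_smul, map_smul, smul_smul,
      mul_inv_cancel₀ hρ.ne', one_smul, ← curl_eq_curlCLM, hφΨ]
  · -- potential bound
    rw [norm_smul, Real.norm_eq_abs, abs_of_pos hρ, mul_comm]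
    exact mul_le_mul_of_nonneg_right ((hC₄ _).trans hK₄) hρ.le

end Summit.NavierStokesRegularity.NavierStokesRegularity.Theorems
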